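import Summits.CriticalPhenomena.PercolationContinuityZ3.Theorems.PercNearOneGluingNoHeavyQuantGatedSliceMixLawQMidsAbsorb
import Summits.CriticalPhenomena.PercolationContinuityZ3.Theorems.PercNearOneGluingNoHeavyQuantGatedSliceMixLawQTwinOpenIneq
import Summits.CriticalPhenomena.PercolationContinuityZ3.Theorems.PercNearOneGluingNoHeavyQuantGatedSliceMixLawQTopOpenIneq
import Summits.CriticalPhenomena.PercolationContinuityZ3.Theorems.PercNearOneGluingNoHeavyQuantLawDecUsageMonge
import HarnessLib

/-!
# QUANT lane R8, T-DEC, leg (III), blob case — `LawDec.GatedSliceMixLaw'`, the Q-ALONE side in REGIME R: the third UNCONDITIONAL class theorem —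
# class `mM` (twin `k₁ + a ≤ t` a mid closed to the zero, top `k₂ > t` a mid OPEN to the zero) with a HEAVY top: `Q` is DEC

builds on p205010 (kernel theorem, internal audit signed; external expert review pending)

Support file (`--supports stmt-CriticalPhenomena-4575`), QUANT lane seat prim-quant-arm-1 (gen 41), rung R8 of
`run/shared/lean/prim/quant/LADDER.md`.  Theorems only, standard axioms, no sorries, no definitions.  Uses `…QuantGatedSliceMixLawQRouting`
(`mixLawQ_decAtT_of_routing`), `…QMidsAbsorb` (`mixLawQ_decAtT_of_midsAbsorb`: every sub-case in which `k₁` fits into its mids), and the scalar lemmas of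
`…QTwinOpenIneq` (`twinOpen_I2_open`, `twinOpen_beta_open` — their hypotheses do not use `K ≤ t`) and `…QTopOpenIneq` (`topOpen_J1`, `topOpen_beta_closedTwin`).
Memo `run/shared/lean/prim/quant/prim-quant-arm-1-g41/Q-ALONE-G41.md` §4b.

THE CELL (18 % of the piece-3 instances of the census).  Frame of the node; `1 ≤ k₁ ≤ j`, `2k₁ < t`; twin `P = k₁ + a ≤ j`, `P ≤ t`, `t ≤ 2P`; top `K = k₂ ≤ j`
with `t < K` (open to the zero) and HEAVY for `k₁` (`y(K − k₁) ≤ t − 2k₁`); `G = k₂ + a ≥ j + 1`.  Then `Q` is `DECAtT y t j (M+a)` (`mixLawQ_decAtT_topOpenHeavy`;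
node corollary).  ROUTING: mids first — whenever `k₁` fits into twin ∪ top the zero is automatic (`…of_midsAbsorb`, which lets the zero use the top's leftover at
rate `t/(K−t)`); otherwise both mids are saturated and the offer inequality `u(z + x_G) ≤ D` follows from the surplus inequalities, UNIVERSAL in the cell
(exact census `work/explore/qmM.py`): twin closed ⟹ J1 `A·W ≤ B·W + C(2K−t)` (63 214 / 63 214), twin open ⟹ I2o `A·W ≤ B(2P−t) + C(2K−t)` (54 557 / 54 557).
HONEST STATUS: the LIGHT-top half of class mM (frequent here: K far above t), classes Mm/MM/MG and the k₂-low classes remain (memo §4(iv)/§4b);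
`GatedSliceMixLaw'` (regime R), CW, `GateMove`, `GatedConvEmptyFree`, `SingleGateConvClosed`, `TreeDEC`, `FarTreeRow` OPEN; RATE class log\* / honest sentence unchanged.

* **`LawDec.mixLawQ_decAtT_topOpenHeavy`**, `LawDec.gatedSliceMixLaw'_topOpenHeavy`.

[this work]; node: prim-quant-stmt g29 (this lane).  Nothing here is cited as a published result.  The gluing rows served
[cite: KozmaNitzan2024, Conjecture 3 (p. 15)]; product measure [cite: Grimmett1999, §1.3 p. 10].
-/

noncomputable section

namespace Summit.CriticalPhenomena.PercolationContinuityZ3.Theorems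

namespace Quant

open Finset

/-- the two-point law `{lo, hi; g}` (as in `…QuantLawDEC`) -/
local notation3 "TP[" lo ", " hi ", " g ", " h "]" =>
  (g : ℝ) * (if (h : ℕ) = (hi : ℕ) then (1 : ℝ) else 0) + (1 - (g : ℝ)) * (if (h : ℕ) = (lo : ℕ) then (1 : ℝ) else 0)

namespace LawDec

set_option maxHeartbeats 800000 in
/-- **CLASS `mM`, HEAVY TOP ⟹ `Q` IS DEC.**  See the file header.  (Heartbeats raised: four routings in one declaration.) [this work] -/
theorem mixLawQ_decAtT_topOpenHeavy (y z g S lam : ℝ) (a j M k₁ k₂ : ℕ)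
    (hy0 : 0 < y) (hy1 : y < 1) (hz0 : 0 ≤ z) (hz1 : z < 1) (hg1 : g ≤ 1) (hyg : y ≤ (1 - z) * g) (ha : 1 ≤ a)
    (hta : y * (M : ℝ) ≤ S) (hk : k₁ ≤ k₂) (hk₂M : k₂ ≤ M) (hlam0 : 0 ≤ lam) (hlam1 : lam ≤ 1)
    (hmean : (1 - z) * ((k₁ : ℝ) + ((k₂ : ℝ) - k₁) * lam) = S)
    (hk₁ : 1 ≤ k₁) (hk₁j : k₁ ≤ j) (hk₁low : 2 * (k₁ : ℝ) < S + (a : ℝ) * g * (1 - z))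
    (hPj : k₁ + a ≤ j) (hPt : ((k₁ : ℝ) + a) ≤ S + (a : ℝ) * g * (1 - z)) (hPmid : S + (a : ℝ) * g * (1 - z) ≤ 2 * ((k₁ : ℝ) + a))
    (hKj : k₂ ≤ j) (hKopen : S + (a : ℝ) * g * (1 - z) < (k₂ : ℝ))
    (hKheavy : y * ((k₂ : ℝ) - k₁) ≤ S + (a : ℝ) * g * (1 - z) - 2 * (k₁ : ℝ))
    (hG : j + 1 ≤ k₂ + a) :
    DECAtT y (S + (a : ℝ) * g * (1 - z)) j (M + a)
      (fun p => z * (if p = 0 then (1 : ℝ) else 0) + (1 - z) * slice (fun q => TP[k₁, k₂, lam, q]) a g p) := by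
  set t : ℝ := S + (a : ℝ) * g * (1 - z) with ht
  set A : ℝ := (1 - z) * (1 - lam) * (1 - g) with hA
  set B : ℝ := (1 - z) * (1 - lam) * g with hB
  set C : ℝ := (1 - z) * lam * (1 - g) with hC
  set D : ℝ := (1 - z) * lam * g with hD
  have hg0 : 0 < g := by
    by_contra hc
    have : (1 - z) * g ≤ 0 := mul_nonpos_of_nonneg_of_nonpos (by linarith) (not_lt.1 hc)
    linarith
  have h1z : 0 < 1 - z := by linarith
  have h1y : 0 < 1 - y := by linarith
  have hyg' : y ≤ g := by nlinarith
  have hA0 : 0 ≤ A := mul_nonneg (mul_nonneg h1z.le (by linarith)) (by linarith)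
  have hB0 : 0 ≤ B := mul_nonneg (mul_nonneg h1z.le (by linarith)) hg0.le
  have hC0 : 0 ≤ C := mul_nonneg (mul_nonneg h1z.le hlam0) (by linarith)
  have hD0 : 0 ≤ D := mul_nonneg (mul_nonneg h1z.le hlam0) hg0.le
  have ha1 : (1 : ℝ) ≤ a := by exact_mod_cast ha
  have hk₁r : (1 : ℝ) ≤ k₁ := by exact_mod_cast hk₁
  have hkr : (k₁ : ℝ) ≤ k₂ := by exact_mod_cast hk
  have ht0 : 0 < t := by linarith
  have hPr : ((k₁ + a : ℕ) : ℝ) = (k₁ : ℝ) + a := by push_cast; ring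
  have hk₁k₂ : (k₁ : ℝ) < k₂ := by linarith
  have hPmid' : t ≤ 2 * ((k₁ + a : ℕ) : ℝ) := by rw [hPr]; exact hPmid
  have hKmid : t ≤ 2 * (k₂ : ℝ) := by linarith
  have hKcomp : t < (k₁ : ℝ) + k₂ := by linarith
  -- mass and mean (pure algebra)
  have hmass : z + A + B + C + D = 1 := by rw [hA, hB, hC, hD]; ring
  have hmom : (k₁ : ℝ) * A + ((k₁ : ℝ) + a) * B + (k₂ : ℝ) * C + ((k₂ : ℝ) + a) * D = t := by
    rw [hA, hB, hC, hD, ht, ← hmean]; ring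
  have htz : t * z = -((t - k₁) * A) - (t - ((k₁ : ℝ) + a)) * B - (t - k₂) * C + ((k₂ : ℝ) + a - t) * D := by
    have e1 : t * z = t * (1 - A - B - C - D) := by rw [← hmass]; ring
    rw [e1]; linarith [hmom]
  have hyG : y * ((k₂ : ℝ) + a) ≤ t := by
    have h1 : y * (k₂ : ℝ) ≤ y * M := mul_le_mul_of_nonneg_left (by exact_mod_cast hk₂M) hy0.le
    have h3 : y * (a : ℝ) ≤ (a : ℝ) * g * (1 - z) := by
      calc y * (a : ℝ) ≤ (1 - z) * g * (a : ℝ) := mul_le_mul_of_nonneg_right hyg (Nat.cast_nonneg a)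
        _ = (a : ℝ) * g * (1 - z) := by ring
    have e : y * ((k₂ : ℝ) + a) = y * (k₂ : ℝ) + y * (a : ℝ) := by ring
    rw [e, ht]; linarith
  have huG : usage y t j k₁ (k₂ + a) = y / (1 - y) := usage_giant_eq y t j k₁ (k₂ + a) hG
  have hcapG_of : ∀ xG : ℝ, y * (z + xG) ≤ (1 - y) * D → usage y t j k₁ (k₂ + a) * xG ≤ D := by
    intro xG hE
    rw [huG, div_mul_eq_mul_div, div_le_iff₀ h1y]
    have : y * xG ≤ y * (z + xG) := by nlinarith
    linarith [mul_comm (1 - y) D]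
  -- the heavy top: `ρ_K = W/(K − k₁)`, `capK = C(1−ρ)/ρ`
  set W : ℝ := t - 2 * (k₁ : ℝ) with hWdef
  have hW0 : 0 < W := by rw [hWdef]; linarith
  have hWne : W ≠ 0 := ne_of_gt hW0
  have ha0 : (0 : ℝ) < a := by linarith
  set ρ : ℝ := W / ((k₂ : ℝ) - k₁) with hρ
  have hd : (0 : ℝ) < (k₂ : ℝ) - k₁ := by linarith
  have hρ0 : 0 < ρ := div_pos hW0 hd
  have hρ1 : ρ < 1 := by rw [hρ, div_lt_one hd, hWdef]; linarith
  have hyρ : y ≤ ρ := by rw [hρ, le_div_iff₀ hd]; exact hKheavy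
  have hKng : ¬ (j + 1 ≤ k₂) := by omega
  have huK : usage y t j k₁ k₂ = ρ / (1 - ρ) := by
    have hmax : y ^ 2 + (1 - y) * ρ ≤ ρ := by
      have h := mul_nonpos_of_nonneg_of_nonpos hy0.le (sub_nonpos.2 hyρ)
      have e : y ^ 2 + (1 - y) * ρ = ρ + y * (y - ρ) := by ring
      rw [e]; linarith
    simp only [usage, gateOf, if_neg hKng, pairGate]
    rw [← hWdef, ← hρ, max_eq_left hmax]
  set capK : ℝ := C * (1 - ρ) / ρ with hcapK
  have hcapK0 : 0 ≤ capK := div_nonneg (mul_nonneg hC0 (sub_nonneg.2 hρ1.le)) hρ0.le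
  have hcapK_eq : capK * W = C * ((k₂ : ℝ) + k₁ - t) := by
    have hdne : (k₂ : ℝ) - k₁ ≠ 0 := ne_of_gt hd
    have hW2 : t - 2 * (k₁ : ℝ) ≠ 0 := by rw [← hWdef]; exact hWne
    have e1 : capK * W = C * (1 - ρ) / ρ * (t - 2 * (k₁ : ℝ)) := by rw [hcapK, hWdef]
    rw [e1, hρ, hWdef]
    field_simp
    ring
  have hρne : 1 - ρ ≠ 0 := ne_of_gt (by linarith)
  have hρne0 : ρ ≠ 0 := ne_of_gt hρ0
  have hsatK : usage y t j k₁ k₂ * capK = C := by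
    rw [huK, hcapK, div_mul_div_comm, mul_comm (1 - ρ) ρ, ← mul_assoc]
    rw [mul_div_mul_right _ _ hρne, mul_comm ρ C, mul_div_assoc, div_self hρne0, mul_one]
  have huK0 : 0 ≤ usage y t j k₁ k₂ := by rw [huK]; exact div_nonneg hρ0.le (by linarith)
  have hPng : ¬ (j + 1 ≤ k₁ + a) := by omega
  -- the offer target of the routing theorem when the top is saturated
  have hoffer_sat : ∀ (xP xG : ℝ), y * (z + xG) ≤ (1 - y) * D →
      t * z ≤
        (if j + 1 ≤ k₁ + a then t * (1 - y) / y else if t < ((k₁ + a : ℕ) : ℝ) then ((k₁ + a : ℕ) : ℝ) - t else 0)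
            * (B - usage y t j k₁ (k₁ + a) * xP)
          + (if j + 1 ≤ k₂ then t * (1 - y) / y else if t < (k₂ : ℝ) then (k₂ : ℝ) - t else 0)
            * (C - usage y t j k₁ k₂ * capK)
          + t * (1 - y) / y * (D - usage y t j k₁ (k₂ + a) * xG) := by
    intro xP xG hE
    rw [if_neg hPng, hPr, if_neg (by linarith : ¬ (t < (k₁ : ℝ) + a)), if_neg hKng, if_pos hKopen, hsatK, huG, zero_mul, sub_self,
      mul_zero, zero_add, zero_add]
    have hz : z ≤ (1 - y) / y * D - xG := by
      rw [div_mul_eq_mul_div, le_sub_iff_add_le, le_div_iff₀ hy0]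
      linarith [hE, mul_comm y (z + xG)]
    have e : t * (1 - y) / y * (D - y / (1 - y) * xG) = t * ((1 - y) / y * D - xG) := by
      have hy0' : y ≠ 0 := ne_of_gt hy0
      have h1y' : 1 - y ≠ 0 := ne_of_gt h1y
      field_simp
    rw [e]
    exact mul_le_mul_of_nonneg_left hz ht0.le
  -- the common data of `mixLawQ_decAtT_of_midsAbsorb`
  have hPabs : t ≤ 2 * ((k₁ + a : ℕ) : ℝ) ∨ j < k₁ + a := Or.inl hPmid'
  have hKabs : t ≤ 2 * (k₂ : ℝ) ∨ j < k₂ := Or.inl hKmid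
  by_cases hPc : t < 2 * (k₁ : ℝ) + a
  · -- the twin is OPEN to `k₁`
    have hWa : W < a := by rw [hWdef]; linarith
    have hPcomp : t < (k₁ : ℝ) + ((k₁ + a : ℕ) : ℝ) := by rw [hPr]; linarith
    have hρP : (t - 2 * (k₁ : ℝ)) / (((k₁ + a : ℕ) : ℝ) - k₁) = W / a := by rw [hPr, hWdef]; ring_nf
    by_cases hWg : W ≤ (a : ℝ) * g
    · -- the twin absorbs `k₁`
      have hpg : pairGate y t k₁ (k₁ + a) ≤ g := by
        simp only [pairGate]
        rw [hρP]
        have h1 : W / a ≤ g := by rw [div_le_iff₀ ha0]; linarith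
        refine max_le h1 ?_
        have h2 : (1 - y) * (W / a) ≤ (1 - y) * g := mul_le_mul_of_nonneg_left h1 h1y.le
        have h3 : y ^ 2 ≤ y * g := by rw [sq]; exact mul_le_mul_of_nonneg_left hyg' hy0.le
        linarith
      have hpg1 : pairGate y t k₁ (k₁ + a) < 1 := pairGate_lt_one y t k₁ (k₁ + a) hy0 hy1 hk₁low hPcomp
      have huse : usage y t j k₁ (k₁ + a) * A ≤ B := by
        have eU : usage y t j k₁ (k₁ + a) = pairGate y t k₁ (k₁ + a) / (1 - pairGate y t k₁ (k₁ + a)) := by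
          simp only [usage, gateOf, if_neg hPng]
        rw [eU, div_mul_eq_mul_div, div_le_iff₀ (by linarith)]
        rw [hA, hB]
        have h1g : 0 ≤ (1 - z) * (1 - lam) := mul_nonneg h1z.le (by linarith)
        have h := mul_le_mul_of_nonneg_left hpg h1g
        have e1 : pairGate y t k₁ (k₁ + a) * ((1 - z) * (1 - lam) * (1 - g))
            = (1 - z) * (1 - lam) * pairGate y t k₁ (k₁ + a) - ((1 - z) * (1 - lam) * pairGate y t k₁ (k₁ + a)) * g := by ring
        have e2 : (1 - z) * (1 - lam) * g * (1 - pairGate y t k₁ (k₁ + a))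
            = (1 - z) * (1 - lam) * g - ((1 - z) * (1 - lam) * pairGate y t k₁ (k₁ + a)) * g := by ring
        rw [e1, e2]
        linarith [h]
      exact mixLawQ_decAtT_of_midsAbsorb y z g S lam a j M k₁ k₂ A 0 hy0 hy1 hz0 hz1 hg1 hyg ha hta hk hk₂M hlam0 hlam1 hmean
        hk₁ hk₁j hk₁low hPabs hKabs hG hA0 le_rfl (by ring) (fun _ => ⟨hPj, hPcomp⟩) (fun h => absurd h (lt_irrefl _))
        huse (by rw [mul_zero]; exact hC0)
    · -- the twin is heavy and saturated
      have hWg' : (a : ℝ) * g < W := not_le.1 hWg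
      have hρP1 : W / a < 1 := by rw [div_lt_one ha0]; exact hWa
      have hρP0 : 0 < W / a := div_pos hW0 ha0
      have hyρP : y ≤ W / a := by
        rw [le_div_iff₀ ha0]
        have h1 : y * (a : ℝ) ≤ g * a := mul_le_mul_of_nonneg_right hyg' ha0.le
        have h2 : g * (a : ℝ) = a * g := mul_comm _ _
        linarith
      have huP : usage y t j k₁ (k₁ + a) = (W / a) / (1 - W / a) := by
        have hmax : y ^ 2 + (1 - y) * (W / a) ≤ W / a := by
          have h := mul_nonpos_of_nonneg_of_nonpos hy0.le (sub_nonpos.2 hyρP)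
          have e : y ^ 2 + (1 - y) * (W / a) = W / a + y * (y - W / a) := by ring
          rw [e]; linarith
        simp only [usage, gateOf, if_neg hPng, pairGate]
        rw [hρP, max_eq_left hmax]
      set capP : ℝ := B * (1 - W / a) / (W / a) with hcapPdef
      have hcapP0 : 0 ≤ capP := div_nonneg (mul_nonneg hB0 (by linarith)) hρP0.le
      have hane : (a : ℝ) ≠ 0 := ne_of_gt ha0
      have hcapP_eq : capP * W = B * (a - W) := by
        rw [hcapPdef]; field_simp
      have hsatP : usage y t j k₁ (k₁ + a) * capP = B := by
        have h1 : 1 - W / a ≠ 0 := ne_of_gt (by linarith)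
        have h2 : W / a ≠ 0 := ne_of_gt hρP0
        rw [huP, hcapPdef, div_mul_div_comm, mul_comm (1 - W / a) (W / a), ← mul_assoc]
        rw [mul_div_mul_right _ _ h1, mul_comm (W / a) B, mul_div_assoc, div_self h2, mul_one]
      have hAcapP : capP ≤ A := by
        have h1 : capP * W ≤ A * W := by
          rw [hcapP_eq, hA, hB]
          have hc : 0 ≤ (1 - z) * (1 - lam) := mul_nonneg h1z.le (by linarith)
          have h := mul_le_mul_of_nonneg_left hWg'.le hc
          have e1 : (1 - z) * (1 - lam) * g * ((a : ℝ) - W) = (1 - z) * (1 - lam) * ((a : ℝ) * g) - (1 - z) * (1 - lam) * W * g := by ring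
          have e2 : (1 - z) * (1 - lam) * (1 - g) * W = (1 - z) * (1 - lam) * W - (1 - z) * (1 - lam) * W * g := by ring
          rw [e1, e2]
          linarith [h]
        exact le_of_mul_le_mul_right h1 hW0
      by_cases hfitK : A - capP ≤ capK
      · -- the rest of `k₁` fits into the top
        have huseK : usage y t j k₁ k₂ * (A - capP) ≤ C := by
          have := mul_le_mul_of_nonneg_left hfitK huK0
          linarith [hsatK]
        exact mixLawQ_decAtT_of_midsAbsorb y z g S lam a j M k₁ k₂ capP (A - capP) hy0 hy1 hz0 hz1 hg1 hyg ha hta hk hk₂M hlam0 hlam1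
          hmean hk₁ hk₁j hk₁low hPabs hKabs hG hcapP0 (by linarith) (by ring) (fun _ => ⟨hPj, hPcomp⟩) (fun _ => ⟨hKj, hKcomp⟩)
          (le_of_eq hsatP) huseK
      · -- both saturated: I2 (open form)
        have eAB : (1 - z) * ((1 - lam) * ((t - 2 * (k₁ : ℝ)) - 2 * (a : ℝ) * g)) = A * W - B * (2 * ((k₁ : ℝ) + a) - t) := by
          rw [hA, hB, hWdef]; ring
        have hI2s := twinOpen_I2_open z g S t lam (k₁ : ℝ) (k₂ : ℝ) (a : ℝ) hz0 hz1 hg0 hg1 hlam0 hlam1 hk₁r ha1 hmean ht hWa hKmid hk₁k₂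
        have hI2 : A * W ≤ B * (2 * ((k₁ : ℝ) + a) - t) + C * (2 * (k₂ : ℝ) - t) := by
          have h := mul_le_mul_of_nonneg_left hI2s h1z.le
          have eC : (1 - z) * (lam * (1 - g) * (2 * (k₂ : ℝ) - t)) = C * (2 * (k₂ : ℝ) - t) := by rw [hC]; ring
          linarith [eAB, eC]
        have hE : y * (z + (A - capP - capK)) ≤ (1 - y) * D :=
          twinOpen_beta_open t y k₁ k₂ a A B C D z capP capK W hy0 ht0 (by linarith) hWdef hW0 htz hyG hD0 hcapP_eq hcapK_eq hI2
        refine mixLawQ_decAtT_of_routing y z g S lam a j M k₁ k₂ capP capK (A - capP - capK) hy0 hy1 hz0 hz1 hg1 hyg ha hta hk hk₂M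
          hlam0 hlam1 hmean hk₁ hk₁j hk₁low hPabs hKabs hG hcapP0 hcapK0 (by linarith [not_le.1 hfitK]) (by ring)
          (fun _ => Or.inr hPcomp) (fun _ => Or.inr hKcomp) (le_of_eq hsatP) (le_of_eq hsatK) (hcapG_of _ hE)
          (hoffer_sat capP (A - capP - capK) hE)
  · -- the twin is CLOSED to `k₁`
    have hPc' : 2 * (k₁ : ℝ) + a ≤ t := not_lt.1 hPc
    by_cases hfitK : A ≤ capK
    · -- `k₁` fits into the top
      have huseK : usage y t j k₁ k₂ * A ≤ C := by
        have := mul_le_mul_of_nonneg_left hfitK huK0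
        linarith [hsatK]
      exact mixLawQ_decAtT_of_midsAbsorb y z g S lam a j M k₁ k₂ 0 A hy0 hy1 hz0 hz1 hg1 hyg ha hta hk hk₂M hlam0 hlam1 hmean
        hk₁ hk₁j hk₁low hPabs hKabs hG le_rfl hA0 (by ring) (fun h => absurd h (lt_irrefl _)) (fun _ => ⟨hKj, hKcomp⟩)
        (by rw [mul_zero]; exact hB0) huseK
    · -- the top is saturated: J1
      have hJ1s := topOpen_J1 z g S t lam (k₁ : ℝ) (k₂ : ℝ) (a : ℝ) hz0 hz1 hg0 hg1 hlam0 hlam1 (by linarith) ha0.le hmean ht hPt hKmid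
        hk₁k₂ hk₁low
      have hJ1 : A * W ≤ B * W + C * (2 * (k₂ : ℝ) - t) := by
        have h := mul_le_mul_of_nonneg_left hJ1s h1z.le
        have e1 : (1 - z) * ((1 - lam) * (1 - 2 * g) * (t - 2 * (k₁ : ℝ))) = A * W - B * W := by rw [hA, hB, hWdef]; ring
        have eC : (1 - z) * (lam * (1 - g) * (2 * (k₂ : ℝ) - t)) = C * (2 * (k₂ : ℝ) - t) := by rw [hC]; ring
        linarith [e1, eC]
      have hE : y * (z + (A - capK)) ≤ (1 - y) * D :=
        topOpen_beta_closedTwin t y k₁ k₂ a A B C D z capK W hy0 ht0 (by linarith) hWdef hW0 htz hyG hPc' hB0 hD0 hcapK_eq hJ1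
      refine mixLawQ_decAtT_of_routing y z g S lam a j M k₁ k₂ 0 capK (A - capK) hy0 hy1 hz0 hz1 hg1 hyg ha hta hk hk₂M hlam0 hlam1
        hmean hk₁ hk₁j hk₁low hPabs hKabs hG le_rfl hcapK0 (by linarith [not_le.1 hfitK]) (by ring)
        (fun h => absurd h (lt_irrefl _)) (fun _ => Or.inr hKcomp) (by rw [mul_zero]; exact hB0) (le_of_eq hsatK) (hcapG_of _ hE)
        (hoffer_sat 0 (A - capK) hE)

/-- **`GatedSliceMixLaw'` with θ = 0 in the heavy-top cell of class `mM`.** [this work] -/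
theorem gatedSliceMixLaw'_topOpenHeavy (y z g S lam : ℝ) (a j M h k₁ k₂ : ℕ)
    (hy0 : 0 < y) (hy1 : y < 1) (hz0 : 0 ≤ z) (hz1 : z < 1) (hg1 : g ≤ 1) (hyg : y ≤ (1 - z) * g) (ha : 1 ≤ a)
    (hta : y * (M : ℝ) ≤ S) (hk : k₁ ≤ k₂) (hk₂M : k₂ ≤ M) (hlam0 : 0 ≤ lam) (hlam1 : lam ≤ 1)
    (hmean : (1 - z) * ((k₁ : ℝ) + ((k₂ : ℝ) - k₁) * lam) = S)
    (hk₁ : 1 ≤ k₁) (hk₁j : k₁ ≤ j) (hk₁low : 2 * (k₁ : ℝ) < S + (a : ℝ) * g * (1 - z))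
    (hPj : k₁ + a ≤ j) (hPt : ((k₁ : ℝ) + a) ≤ S + (a : ℝ) * g * (1 - z)) (hPmid : S + (a : ℝ) * g * (1 - z) ≤ 2 * ((k₁ : ℝ) + a))
    (hKj : k₂ ≤ j) (hKopen : S + (a : ℝ) * g * (1 - z) < (k₂ : ℝ))
    (hKheavy : y * ((k₂ : ℝ) - k₁) ≤ S + (a : ℝ) * g * (1 - z) - 2 * (k₁ : ℝ))
    (hG : j + 1 ≤ k₂ + a) :
    ∃ θ : ℝ, 0 ≤ θ ∧ θ < 1 ∧
      DECAtT y (S + (a : ℝ) * g * (1 - z)) j (M + a)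
        (fun p => θ * weakMidLaw S g h a p
          + (1 - θ) * (z * (if p = 0 then (1 : ℝ) else 0) + (1 - z) * slice (fun q => TP[k₁, k₂, lam, q]) a g p)) := by
  refine ⟨0, le_rfl, zero_lt_one, ?_⟩
  refine decAtT_congr (fun p => ?_)
    (mixLawQ_decAtT_topOpenHeavy y z g S lam a j M k₁ k₂ hy0 hy1 hz0 hz1 hg1 hyg ha hta hk hk₂M hlam0 hlam1 hmean hk₁ hk₁j hk₁low hPj
      hPt hPmid hKj hKopen hKheavy hG)
  ring

end LawDec

end Quant

end Summit.CriticalPhenomena.PercolationContinuityZ3.Theorems
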